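import Summits.QuantumFields.YangMills.Theorems.BalabanUVNodesN18TwoRunLettersCalculus

/-!
# BalabanUVNodes ∕ N18 — THE TWO-RUN CLOSENESS-LETTER CALCULUS, PART 2 (SUMS, SCALARS, INVERSES, SQUARE ROOT): the END's
# two-run closeness letters (C1) ∕ (C2) of `N18TwoRunLetters.termWalkData_of_staticLetters_at_window` for sums and scalar
# multiples, their monotonicity ∕ symmetry, (C1) of the INVERSE of a static precision family (resolvent identity) and (C1) of
# the SQUARE-ROOT factor `(P(σ))^{−1/2}` ([Balaban1988RG2Cluster] (2.7) p. 13) — companion of part 1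
# `BalabanUVNodesN18TwoRunLettersCalculus` (products) (Track A, DAG node N18 = NE5 `T4OutputRate.NE5 EA EB W κ θ C₅`; cluster K4)

Cell `pub-ymgap`, HUMAN RULING D-0149 (T⁴ apex work-bound push), width seat `pub-ymgap-dag-n18-w1` (g0); W-SEAT-START-LIST v3 §2 n18 item 1
(«`N18At` at the record … start from `…N18EndLetters` ∕ `…N18TwoRunLetters` currency»), SUB-LEMMA «two-run closeness-letter calculus», part 2.
`--kind proof --supports stmt-QuantumFields-20544` (K3⁷ `SpineGivenEndpointR13SepCoPH`) as a HELPER — COUNT-NEUTRAL.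

HONEST FRAMING.  Finite-matrix bookkeeping; THEOREMS ONLY, 0 `def`, 0 `sorry`, standard axioms.  Every letter is a HYPOTHESIS about abstract
static kernel ∕ precision families `σ ↦ K(σ)`, `σ ↦ A(σ)`, `σ ↦ P(σ)`; nothing of Bałaban's `Γ_k`, `Δ^{(k)}(Z₀,σ,𝐔,𝐉)`, `C^{(k)}`, `(C^{(k)})^{1/2}` is
constructed or asserted; the PRIMITIVE two-run closeness letters (rows NE2∕NE3's η-rate for Bałaban's propagators; NODE O 0∕1) are NOT supplied;
NE5 NOT IN PRINT ([Balaban1987RG1] Thm 1 p. 259) and NOT PROVED; N18 NOT discharged; counts UNMOVED (typed 28∕28 · discharged 5∕27); one finite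
four-torus programme at fixed ε — NOT continuum, NOT ℝ⁴, NOT OS, NOT a mass gap, NOT Clay.
A6 ∕ SATISFIABILITY (№189).  The displayed hypotheses of every theorem below are JOINTLY SATISFIABLE — e.g. identical runs (`K_A = K_B`, `A_A = A_B`,
`P_A = P_B`, rate `ϱ = 0`) with constant-in-σ families, the precision `P(σ) := m·1` (range one, `m`-accretive, off-diagonal sums `0`), any `X ≠ ∅` — so no
statement is vacuous; they carry CONTENT only when instantiated at Bałaban's primitives with rows NE2∕NE3's rate, which this file does not do.

WHAT (part 1's header has THE POINT; binder shapes = `N18TwoRunLetters` §3∕§4: (C1) `‖K_B(σ)_{ij} − K_A(σ)_{ij}‖ ≤ ϱ·(B·e^{−ρ·dst})`, (C2) the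
same for the σ-localised pieces `K(σ) − K(0)` through `X`):
* §3 `close_add`, `locClose_add` (amplitudes add), `close_smul`, `locClose_smul` (`‖z‖·B`), `close_mono` (rate `ϱ ≤ ϱ′`, amplitude `B ≤ B′`,
  decay `ρ′ ≤ ρ`), `close_symm` — stated over an arbitrary weight `dst` (`d₁` for (C1), `d_X` for (C2)).
* §4 INVERSES (the precision slot's (L4)∕(C3) currency): `close_inv` — (C1) of `σ ↦ (A(σ))⁻¹` from (C1) of `A`, NODE O's (L4) decay of BOTH
  inverses and the invertibility (C3) of both: `A_B⁻¹ − A_A⁻¹ = A_B⁻¹(A_A − A_B)A_A⁻¹` (`Matrix.inv_sub_inv`) and part 1 §1 twice; amplitude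
  `B_C²B_Ec_V²`, decay `ρ′` with `ρ′ + 2η ≤ ρ` — King's mechanism for a propagator `G = Δ⁻¹` read at two lattice spacings, walk-free.
* §5 SQUARE ROOT: `close_invSqrt` — (C1) of `σ ↦ (P(σ))^{−1/2}` for `m`-accretive range-one precision families from (C1) of `P`: dag-n10-b's
  `B13Sqrt27Accretive.norm_invSqrt_sub_apply_le` (the resolvent identity inside the `x^{−1/2}` integral of (2.7)) at `T := P_B(σ)`, `T′ := P_A(σ)`
  in located-torus currency (weight `d₁(loc·,loc·)∕s`, as in `NodeOLettersSqrt.kernelLetters_invSqrt`); amplitude `4ϱB_Ec_V²∕(m√m)`, decay `θ′∕s`.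
* §6 THE Γ-KERNEL SHAPE: `close_mul_invSqrt` — (C1) of `σ ↦ K(σ)·(P(σ))^{−1/2}` («local factor × square root of the covariance», p. 13) END TO
  END from (L1)+(C1) of the local factor and §5's precision data (part 1 `close_mul` ∘ `close_invSqrt` ∘ `norm_invSqrt_apply_le`): amplitude
  `(D_K·(2∕√m) + B_K·(4B_Ec_V²∕(m√m)))·c_V₁` — the `hcloseΓ` binder of `termWalkData_of_staticLetters_at_window` for such a kernel, by name.
NOT COVERED (honest): (C2) of the inverse and of the square-root factor (second-order resolvent expansions; follow-on); letters for Bałaban's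
actual primitives; the END's other binders.

Sources (mechanism and shapes only; nothing printed is asserted): T. Bałaban, CMP **116** (1988) [Balaban1988RG2Cluster] (1.11) p. 5, (2.7)
p. 13, p. 15, (2.16) p. 16; CMP **99** (1985) [Balaban1985BackgroundPropagators] (3.93) p. 410, Thm 3.10 p. 416; CMP **96** (1984)
[Balaban1984PropagatorsII] (2.54)–(2.56) p. 233; C. King, CMP **102** (1986) [King1986] p. 665.  Nothing here is a claim about the Yang–Mills
mass gap.
-/

noncomputable section

namespace Summit.QuantumFields.YangMills.BalabanUVNodes.N18TwoRunLettersCalculusResolvent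

open Metric Set Finset
open scoped Matrix
open Literature.MathematicalPhysics.QuantumFieldTheory.Balaban1983to89
open Literature.MathematicalPhysics.QuantumFieldTheory.Balaban1983to89.B9Thm37GlueTorus (tdist1 tdist1_nonneg tdist1_triangle tdist1_self)
open Literature.MathematicalPhysics.QuantumFieldTheory.Balaban1983to89.TreeLengthTorus (TPt)
open Literature.MathematicalPhysics.QuantumFieldTheory.Balaban1983to89.B5TorusCover (UT)
open Literature.MathematicalPhysics.QuantumFieldTheory.Balaban1983to89.NodeOLetters (distX distX_nonneg)
open Literature.MathematicalPhysics.QuantumFieldTheory.Balaban1983to89.B13Sqrt27Accretive (invSqrt norm_invSqrt_apply_le norm_invSqrt_sub_apply_le)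
open Summit.QuantumFields.YangMills.BalabanUVNodes.N18TwoRunLettersCalculus (norm_mul_apply_le_of_decay close_mul)

variable {d N' : ℕ} {ν : ℕ} {Nf : Fin ν → ℕ} [∀ i, NeZero (Nf i)]

/-! ## §3 SUMS, SCALAR MULTIPLES, MONOTONICITY, SYMMETRY of the two-run closeness letters -/

section Linear

variable {p n : Type} {c : B13.Consts} {locp : p → UT Nf} {locn : n → UT Nf}
  {KA₁ KB₁ KA₂ KB₂ KA KB : (TPt d N' → ℂ) → Matrix p n ℂ} {dst : UT Nf → UT Nf → ℝ} {ρ ρ' ϱ ϱ' B B' B₁ B₂ : ℝ}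

omit [∀ i, NeZero (Nf i)] in
/-- **(C1)∕(C2) OF A SUM** (one statement for both letters: `dst = d₁` or `dst = d_X`, and for (C2) read `K(σ)` as the σ-localised piece):
amplitudes add. [cite: King1986, p.665] -/
theorem close_add
    (h₁ : ∀ σ : TPt d N' → ℂ, (∀ j, ‖σ j‖ ≤ Real.exp c.κ₁) →
      ∀ i j, ‖KB₁ σ i j - KA₁ σ i j‖ ≤ ϱ * (B₁ * Real.exp (-(ρ * dst (locp i) (locn j)))))
    (h₂ : ∀ σ : TPt d N' → ℂ, (∀ j, ‖σ j‖ ≤ Real.exp c.κ₁) →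
      ∀ i j, ‖KB₂ σ i j - KA₂ σ i j‖ ≤ ϱ * (B₂ * Real.exp (-(ρ * dst (locp i) (locn j))))) :
    ∀ σ : TPt d N' → ℂ, (∀ j, ‖σ j‖ ≤ Real.exp c.κ₁) →
      ∀ i j, ‖(KB₁ σ + KB₂ σ) i j - (KA₁ σ + KA₂ σ) i j‖ ≤ ϱ * ((B₁ + B₂) * Real.exp (-(ρ * dst (locp i) (locn j)))) := by
  intro σ hσ i j
  have e : (KB₁ σ + KB₂ σ) i j - (KA₁ σ + KA₂ σ) i j = (KB₁ σ i j - KA₁ σ i j) + (KB₂ σ i j - KA₂ σ i j) := by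
    simp only [Matrix.add_apply]; ring
  rw [e]
  calc ‖(KB₁ σ i j - KA₁ σ i j) + (KB₂ σ i j - KA₂ σ i j)‖ ≤ ‖KB₁ σ i j - KA₁ σ i j‖ + ‖KB₂ σ i j - KA₂ σ i j‖ := norm_add_le _ _
    _ ≤ _ := (add_le_add (h₁ σ hσ i j) (h₂ σ hσ i j)).trans_eq (by ring)

omit [∀ i, NeZero (Nf i)] in
/-- **(C2) OF A SUM** in the END's literal four-term shape: the σ-localised two-run differences add. [cite: King1986, p.665] -/
theorem locClose_add
    (h₁ : ∀ σ : TPt d N' → ℂ, (∀ j, ‖σ j‖ ≤ Real.exp c.κ₁) →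
      ∀ i j, ‖(KB₁ σ i j - KB₁ 0 i j) - (KA₁ σ i j - KA₁ 0 i j)‖ ≤ ϱ * (B₁ * Real.exp (-(ρ * dst (locp i) (locn j)))))
    (h₂ : ∀ σ : TPt d N' → ℂ, (∀ j, ‖σ j‖ ≤ Real.exp c.κ₁) →
      ∀ i j, ‖(KB₂ σ i j - KB₂ 0 i j) - (KA₂ σ i j - KA₂ 0 i j)‖ ≤ ϱ * (B₂ * Real.exp (-(ρ * dst (locp i) (locn j))))) :
    ∀ σ : TPt d N' → ℂ, (∀ j, ‖σ j‖ ≤ Real.exp c.κ₁) →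
      ∀ i j, ‖((KB₁ σ + KB₂ σ) i j - (KB₁ 0 + KB₂ 0) i j) - ((KA₁ σ + KA₂ σ) i j - (KA₁ 0 + KA₂ 0) i j)‖
        ≤ ϱ * ((B₁ + B₂) * Real.exp (-(ρ * dst (locp i) (locn j)))) := by
  intro σ hσ i j
  have e : ((KB₁ σ + KB₂ σ) i j - (KB₁ 0 + KB₂ 0) i j) - ((KA₁ σ + KA₂ σ) i j - (KA₁ 0 + KA₂ 0) i j) =
      ((KB₁ σ i j - KB₁ 0 i j) - (KA₁ σ i j - KA₁ 0 i j)) + ((KB₂ σ i j - KB₂ 0 i j) - (KA₂ σ i j - KA₂ 0 i j)) := by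
    simp only [Matrix.add_apply]; ring
  rw [e]
  exact (norm_add_le _ _).trans ((add_le_add (h₁ σ hσ i j) (h₂ σ hσ i j)).trans_eq (by ring))

omit [∀ i, NeZero (Nf i)] in
/-- **(C1)∕(C2) OF A SCALAR MULTIPLE** `z·K` (`z ∈ ℂ` fixed, e.g. a coupling or a weight): amplitude `‖z‖·B`. [cite: King1986, p.665] -/
theorem close_smul (z : ℂ)
    (h : ∀ σ : TPt d N' → ℂ, (∀ j, ‖σ j‖ ≤ Real.exp c.κ₁) →
      ∀ i j, ‖KB σ i j - KA σ i j‖ ≤ ϱ * (B * Real.exp (-(ρ * dst (locp i) (locn j))))) :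
    ∀ σ : TPt d N' → ℂ, (∀ j, ‖σ j‖ ≤ Real.exp c.κ₁) →
      ∀ i j, ‖(z • KB σ) i j - (z • KA σ) i j‖ ≤ ϱ * ((‖z‖ * B) * Real.exp (-(ρ * dst (locp i) (locn j)))) := by
  intro σ hσ i j
  rw [Matrix.smul_apply, Matrix.smul_apply, ← smul_sub, norm_smul]
  calc ‖z‖ * ‖KB σ i j - KA σ i j‖ ≤ ‖z‖ * (ϱ * (B * Real.exp (-(ρ * dst (locp i) (locn j))))) :=
        mul_le_mul_of_nonneg_left (h σ hσ i j) (norm_nonneg z)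
    _ = _ := by ring

omit [∀ i, NeZero (Nf i)] in
/-- **(C2) OF A SCALAR MULTIPLE** in the END's literal four-term shape. [cite: King1986, p.665] -/
theorem locClose_smul (z : ℂ)
    (h : ∀ σ : TPt d N' → ℂ, (∀ j, ‖σ j‖ ≤ Real.exp c.κ₁) →
      ∀ i j, ‖(KB σ i j - KB 0 i j) - (KA σ i j - KA 0 i j)‖ ≤ ϱ * (B * Real.exp (-(ρ * dst (locp i) (locn j))))) :
    ∀ σ : TPt d N' → ℂ, (∀ j, ‖σ j‖ ≤ Real.exp c.κ₁) →
      ∀ i j, ‖((z • KB σ) i j - (z • KB 0) i j) - ((z • KA σ) i j - (z • KA 0) i j)‖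
        ≤ ϱ * ((‖z‖ * B) * Real.exp (-(ρ * dst (locp i) (locn j)))) := by
  intro σ hσ i j
  have e : ((z • KB σ) i j - (z • KB 0) i j) - ((z • KA σ) i j - (z • KA 0) i j) =
      z * ((KB σ i j - KB 0 i j) - (KA σ i j - KA 0 i j)) := by
    simp only [Matrix.smul_apply, smul_eq_mul]; ring
  rw [e, norm_mul]
  calc ‖z‖ * ‖(KB σ i j - KB 0 i j) - (KA σ i j - KA 0 i j)‖ ≤ ‖z‖ * (ϱ * (B * Real.exp (-(ρ * dst (locp i) (locn j))))) :=
        mul_le_mul_of_nonneg_left (h σ hσ i j) (norm_nonneg z)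
    _ = _ := by ring

omit [∀ i, NeZero (Nf i)] in
/-- **MONOTONICITY** of a closeness letter in the rate `ϱ ≤ ϱ′`, the amplitude `B ≤ B′` and the decay `ρ′ ≤ ρ` (on a non-negative weight) — how
the product's doubled amplitudes of §2 are matched to a chosen common letter block. [folklore] -/
theorem close_mono (hdst : ∀ a b, 0 ≤ dst a b) (hϱ : 0 ≤ ϱ) (hϱ' : ϱ ≤ ϱ') (hB : 0 ≤ B) (hBB' : B ≤ B') (hρ' : ρ' ≤ ρ)
    (h : ∀ σ : TPt d N' → ℂ, (∀ j, ‖σ j‖ ≤ Real.exp c.κ₁) →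
      ∀ i j, ‖KB σ i j - KA σ i j‖ ≤ ϱ * (B * Real.exp (-(ρ * dst (locp i) (locn j))))) :
    ∀ σ : TPt d N' → ℂ, (∀ j, ‖σ j‖ ≤ Real.exp c.κ₁) →
      ∀ i j, ‖KB σ i j - KA σ i j‖ ≤ ϱ' * (B' * Real.exp (-(ρ' * dst (locp i) (locn j)))) := by
  intro σ hσ i j
  refine (h σ hσ i j).trans ?_
  have he : Real.exp (-(ρ * dst (locp i) (locn j))) ≤ Real.exp (-(ρ' * dst (locp i) (locn j))) :=
    Real.exp_le_exp.2 (neg_le_neg (mul_le_mul_of_nonneg_right hρ' (hdst _ _)))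
  have hB' : 0 ≤ B' := hB.trans hBB'
  calc ϱ * (B * Real.exp (-(ρ * dst (locp i) (locn j)))) ≤ ϱ * (B' * Real.exp (-(ρ' * dst (locp i) (locn j)))) :=
        mul_le_mul_of_nonneg_left (mul_le_mul hBB' he (Real.exp_pos _).le hB') hϱ
    _ ≤ ϱ' * (B' * Real.exp (-(ρ' * dst (locp i) (locn j)))) :=
        mul_le_mul_of_nonneg_right hϱ' (mul_nonneg hB' (Real.exp_pos _).le)

omit [∀ i, NeZero (Nf i)] in
/-- **SYMMETRY**: the letters do not see which run is called A. [folklore] -/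
theorem close_symm
    (h : ∀ σ : TPt d N' → ℂ, (∀ j, ‖σ j‖ ≤ Real.exp c.κ₁) →
      ∀ i j, ‖KB σ i j - KA σ i j‖ ≤ ϱ * (B * Real.exp (-(ρ * dst (locp i) (locn j))))) :
    ∀ σ : TPt d N' → ℂ, (∀ j, ‖σ j‖ ≤ Real.exp c.κ₁) →
      ∀ i j, ‖KA σ i j - KB σ i j‖ ≤ ϱ * (B * Real.exp (-(ρ * dst (locp i) (locn j)))) :=
  fun σ hσ i j => (norm_sub_rev _ _).trans_le (h σ hσ i j)

end Linear

/-! ## §4 INVERSES: (C1) of `σ ↦ (A(σ))⁻¹` from (C1) of `A`, NODE O's (L4) for both inverses and (C3) invertibility — the resolvent identity -/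

section Inverse

variable {Λ : Type} [Fintype Λ] [DecidableEq Λ] {c : B13.Consts} {locΛ : Λ → UT Nf}
  {AA AB : (TPt d N' → ℂ) → Matrix Λ Λ ℂ} {ρ ρ' η cV ϱ BE BC : ℝ}

/-- **(C1) OF THE INVERSE PRECISION** (the precision slot's (L4)∕(C3) currency).  Static square families `A_A, A_B` on the polydisc with the
invertibility letter (C3) `A(σ)·(A(σ))⁻¹ = 1` for BOTH runs, NODE O's letter (L4) `‖(A(σ))⁻¹_{ik}‖ ≤ B_C·e^{−ρd₁(i,k)}` for BOTH runs, the two-run letter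
(C1) for `A` at rate `ϱ ≥ 0`, amplitude `B_E`, all at decay `ρ`; volume sums `c_V` ⟹ (C1) for the inverses at rate `ϱ`, amplitude `B_C²B_Ec_V²`, decay
`ρ′` with `ρ′ + 2η ≤ ρ`, by `A_B⁻¹ − A_A⁻¹ = A_B⁻¹(A_A − A_B)A_A⁻¹` (`Matrix.inv_sub_inv`) and §1 twice.  This is King's mechanism for a propagator
`G = Δ⁻¹` read at two lattice spacings, walk-free. [cite: King1986, p.665; Balaban1988RG2Cluster, (1.11) p.5; Balaban1985BackgroundPropagators, Thm 3.10 p.416] -/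
theorem close_inv (hϱ : 0 ≤ ϱ) (hBE : 0 ≤ BE) (hBC : 0 ≤ BC) (hρ' : 0 ≤ ρ') (hη : 0 ≤ η) (hsplit : ρ' + 2 * η ≤ ρ)
    (hinvA : ∀ σ : TPt d N' → ℂ, (∀ j, ‖σ j‖ ≤ Real.exp c.κ₁) → AA σ * (AA σ)⁻¹ = 1)
    (hinvB : ∀ σ : TPt d N' → ℂ, (∀ j, ‖σ j‖ ≤ Real.exp c.κ₁) → AB σ * (AB σ)⁻¹ = 1)
    (hC4A : ∀ σ : TPt d N' → ℂ, (∀ j, ‖σ j‖ ≤ Real.exp c.κ₁) →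
      ∀ i k, ‖(AA σ)⁻¹ i k‖ ≤ BC * Real.exp (-(ρ * tdist1 Nf (locΛ i) (locΛ k))))
    (hC4B : ∀ σ : TPt d N' → ℂ, (∀ j, ‖σ j‖ ≤ Real.exp c.κ₁) →
      ∀ i k, ‖(AB σ)⁻¹ i k‖ ≤ BC * Real.exp (-(ρ * tdist1 Nf (locΛ i) (locΛ k))))
    (hclose : ∀ σ : TPt d N' → ℂ, (∀ j, ‖σ j‖ ≤ Real.exp c.κ₁) →
      ∀ i k, ‖AB σ i k - AA σ i k‖ ≤ ϱ * (BE * Real.exp (-(ρ * tdist1 Nf (locΛ i) (locΛ k)))))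
    (hvol : ∀ i, ∑ k, Real.exp (-(η * tdist1 Nf (locΛ i) (locΛ k))) ≤ cV) :
    ∀ σ : TPt d N' → ℂ, (∀ j, ‖σ j‖ ≤ Real.exp c.κ₁) →
      ∀ i j, ‖(AB σ)⁻¹ i j - (AA σ)⁻¹ i j‖ ≤ ϱ * ((BC ^ 2 * BE * cV ^ 2) * Real.exp (-(ρ' * tdist1 Nf (locΛ i) (locΛ j)))) := by
  intro σ hσ i j
  have hUA : IsUnit (AA σ) := (Matrix.isUnit_iff_isUnit_det _).2 (Matrix.isUnit_det_of_right_inverse (hinvA σ hσ))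
  have hUB : IsUnit (AB σ) := (Matrix.isUnit_iff_isUnit_det _).2 (Matrix.isUnit_det_of_right_inverse (hinvB σ hσ))
  have hres : (AB σ)⁻¹ - (AA σ)⁻¹ = (AB σ)⁻¹ * (AA σ - AB σ) * (AA σ)⁻¹ := Matrix.inv_sub_inv (iff_of_true hUB hUA)
  have hcV : 0 ≤ cV := (Finset.sum_nonneg fun k _ => (Real.exp_pos _).le).trans (hvol i)
  have hρ₁ : 0 ≤ ρ' + η := add_nonneg hρ' hη
  have hsplit₁ : (ρ' + η) + η ≤ ρ := by linarith
  -- first line: `A_B⁻¹ (A_A − A_B)` at decay `ρ′ + η`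
  have t1 : ∀ i k, ‖((AB σ)⁻¹ * (AA σ - AB σ)) i k‖ ≤ BC * (ϱ * BE) * cV * Real.exp (-((ρ' + η) * tdist1 Nf (locΛ i) (locΛ k))) :=
    norm_mul_apply_le_of_decay locΛ locΛ locΛ (M₁ := (AB σ)⁻¹) (M₂ := AA σ - AB σ) hBC (mul_nonneg hϱ hBE) hρ₁ hη hsplit₁
      (hC4B σ hσ) (fun k l => by rw [Matrix.sub_apply, norm_sub_rev, mul_assoc]; exact hclose σ hσ k l) hvol
  -- the right factor at the weaker decay `ρ′ + η ≤ ρ`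
  have hC4A' : ∀ k l, ‖(AA σ)⁻¹ k l‖ ≤ BC * Real.exp (-((ρ' + η) * tdist1 Nf (locΛ k) (locΛ l))) := fun k l =>
    (hC4A σ hσ k l).trans (mul_le_mul_of_nonneg_left
      (Real.exp_le_exp.2 (neg_le_neg (mul_le_mul_of_nonneg_right (by linarith) (tdist1_nonneg _ _)))) hBC)
  have t2 := norm_mul_apply_le_of_decay locΛ locΛ locΛ (M₁ := (AB σ)⁻¹ * (AA σ - AB σ)) (M₂ := (AA σ)⁻¹)
    (a := BC * (ϱ * BE) * cV) (b := BC) (mul_nonneg (mul_nonneg hBC (mul_nonneg hϱ hBE)) hcV) hBC hρ' hη le_rfl t1 hC4A' hvol i j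
  rw [← Matrix.sub_apply, hres]
  exact t2.trans_eq (by ring)

end Inverse

/-! ## §5 SQUARE ROOT: (C1) of `σ ↦ (P(σ))^{−1/2}` from (C1) of the precision — `norm_invSqrt_sub_apply_le` at `T := P_B(σ), T′ := P_A(σ)` -/

section Sqrt

variable {Λ : Type} [Fintype Λ] [DecidableEq Λ] {c : B13.Consts}

/-- **(C1) OF THE SQUARE-ROOT FACTOR `(σ) ↦ (P(σ))^{−1/2}`** ([Balaban1988RG2Cluster] (2.7) p. 13: `(C^{(k)})^{1/2} = (C*Δ_kC)^{−1/2} =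
(1/π)∫₀^∞ dx x^{−1/2}(xI + C*Δ_kC)^{−1}`).  Static precision families `P_A, P_B : Λ × Λ` on the polydisc, both `m`-accretive with range one and
off-diagonal row ∕ column sums `≤ h` in an ℕ-valued pseudo-metric `dist` on the bonds dominating the located torus distance (`d₁(loc i, loc j) ≤ s·dist i j`,
`s > 0`), `h(e^θ − 1) ≤ m∕2`; the two-run letter (C1) for `P` at rate `ϱ ≥ 0`, amplitude `B_E`, decay `ρ`; volume sums at `η`; rates `0 ≤ θ′ ≤ ρ·s`,
`θ′ + η ≤ θ` ⟹ (C1) for the square roots at rate `ϱ`, amplitude `4B_Ec_V²∕(m√m)`, decay `θ′∕s` — dag-n10-b's `B13Sqrt27Accretive.norm_invSqrt_sub_apply_le`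
(the resolvent identity inside the `x^{−1/2}` integral) at `T := P_B(σ)`, `T′ := P_A(σ)` with the weight `D := d₁(loc·,loc·)∕s`.  With §2 this carries a
primitive two-run rate of the precision to the Γ-kernel read as «local factor × square root» (p. 13).
[cite: Balaban1988RG2Cluster, (2.7) p.13, p.15, (2.16) p.16; Balaban1985BackgroundPropagators, Thm 3.10 p.416; King1986, p.665] -/
theorem close_invSqrt (locΛ : Λ → UT Nf) (PA PB : (TPt d N' → ℂ) → Matrix Λ Λ ℂ)
    (dist : Λ → Λ → ℕ) (hd0 : ∀ i, dist i i = 0) (hds : ∀ i j, dist i j = dist j i)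
    (hdt : ∀ i j k, dist i k ≤ dist i j + dist j k)
    {s : ℝ} (hs : 0 < s) (hloc : ∀ i j, tdist1 Nf (locΛ i) (locΛ j) ≤ s * dist i j)
    {h m θ η cV BE ρ θ' ϱ : ℝ} (hm : 0 < m) (hθ : 0 ≤ θ) (hhθ : h * (Real.exp θ - 1) ≤ m / 2)
    (hBE : 0 ≤ BE) (hϱ : 0 ≤ ϱ) (hθ' : 0 ≤ θ') (hθ'ρ : θ' ≤ ρ * s) (hθ'η : θ' + η ≤ θ)
    (hrangeA : ∀ σ : TPt d N' → ℂ, (∀ j, ‖σ j‖ ≤ Real.exp c.κ₁) → ∀ i j, PA σ i j ≠ 0 → dist i j ≤ 1)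
    (hrangeB : ∀ σ : TPt d N' → ℂ, (∀ j, ‖σ j‖ ≤ Real.exp c.κ₁) → ∀ i j, PB σ i j ≠ 0 → dist i j ≤ 1)
    (hrowA : ∀ σ : TPt d N' → ℂ, (∀ j, ‖σ j‖ ≤ Real.exp c.κ₁) → ∀ i, ∑ j ∈ univ.filter (fun j => dist i j ≠ 0), ‖PA σ i j‖ ≤ h)
    (hcolA : ∀ σ : TPt d N' → ℂ, (∀ j, ‖σ j‖ ≤ Real.exp c.κ₁) → ∀ j, ∑ i ∈ univ.filter (fun i => dist i j ≠ 0), ‖PA σ i j‖ ≤ h)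
    (hrowB : ∀ σ : TPt d N' → ℂ, (∀ j, ‖σ j‖ ≤ Real.exp c.κ₁) → ∀ i, ∑ j ∈ univ.filter (fun j => dist i j ≠ 0), ‖PB σ i j‖ ≤ h)
    (hcolB : ∀ σ : TPt d N' → ℂ, (∀ j, ‖σ j‖ ≤ Real.exp c.κ₁) → ∀ j, ∑ i ∈ univ.filter (fun i => dist i j ≠ 0), ‖PB σ i j‖ ≤ h)
    (haccA : ∀ σ : TPt d N' → ℂ, (∀ j, ‖σ j‖ ≤ Real.exp c.κ₁) →
      ∀ v : Λ → ℂ, m * ∑ i, ‖v i‖ ^ 2 ≤ (∑ i, star (v i) * (PA σ *ᵥ v) i).re)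
    (haccB : ∀ σ : TPt d N' → ℂ, (∀ j, ‖σ j‖ ≤ Real.exp c.κ₁) →
      ∀ v : Λ → ℂ, m * ∑ i, ‖v i‖ ^ 2 ≤ (∑ i, star (v i) * (PB σ *ᵥ v) i).re)
    (hclose : ∀ σ : TPt d N' → ℂ, (∀ j, ‖σ j‖ ≤ Real.exp c.κ₁) →
      ∀ k l, ‖PB σ k l - PA σ k l‖ ≤ ϱ * (BE * Real.exp (-(ρ * tdist1 Nf (locΛ k) (locΛ l)))))
    (hvol : ∀ i, ∑ k, Real.exp (-(η * dist i k)) ≤ cV) (hvol' : ∀ j, ∑ l, Real.exp (-(η * dist l j)) ≤ cV) :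
    ∀ σ : TPt d N' → ℂ, (∀ j, ‖σ j‖ ≤ Real.exp c.κ₁) →
      ∀ i j, ‖invSqrt (PB σ) i j - invSqrt (PA σ) i j‖
        ≤ ϱ * ((4 * BE * cV ^ 2 / (m * Real.sqrt m)) * Real.exp (-(θ' / s * tdist1 Nf (locΛ i) (locΛ j)))) := by
  intro σ hσ i j
  set D : Λ → Λ → ℝ := fun k l => tdist1 Nf (locΛ k) (locΛ l) / s with hDdef
  have hD0 : ∀ k l, 0 ≤ D k l := fun k l => div_nonneg (tdist1_nonneg _ _) hs.le
  have hD : ∀ i k l j, D i j ≤ dist i k + D k l + dist l j := by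
    intro i k l j
    have h1 : tdist1 Nf (locΛ i) (locΛ j) ≤ tdist1 Nf (locΛ i) (locΛ k) + tdist1 Nf (locΛ k) (locΛ l) + tdist1 Nf (locΛ l) (locΛ j) := by
      linarith [tdist1_triangle (locΛ i) (locΛ l) (locΛ j), tdist1_triangle (locΛ i) (locΛ k) (locΛ l)]
    have h2 : tdist1 Nf (locΛ i) (locΛ j) ≤ s * dist i k + tdist1 Nf (locΛ k) (locΛ l) + s * dist l j := by
      linarith [hloc i k, hloc l j]
    calc D i j = tdist1 Nf (locΛ i) (locΛ j) / s := rfl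
      _ ≤ (s * dist i k + tdist1 Nf (locΛ k) (locΛ l) + s * dist l j) / s := div_le_div_of_nonneg_right h2 hs.le
      _ = dist i k + D k l + dist l j := by simp only [hDdef]; field_simp
  have hE : ∀ k l, ‖(PB σ - PA σ) k l‖ ≤ ϱ * BE * Real.exp (-(ρ * s * D k l)) := by
    intro k l
    have : ρ * s * D k l = ρ * tdist1 Nf (locΛ k) (locΛ l) := by simp only [hDdef]; field_simp
    rw [this, Matrix.sub_apply, mul_assoc]
    exact hclose σ hσ k l
  have h2 := norm_invSqrt_sub_apply_le dist hd0 hds hdt (PB σ) (PA σ) (hrangeB σ hσ) (hrangeA σ hσ) h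
    (hrowB σ hσ) (hcolB σ hσ) (hrowA σ hσ) (hcolA σ hσ) m θ hm hθ (haccB σ hσ) (haccA σ hσ) hhθ D hD0 hD
    (B := ϱ * BE) (ρ := ρ * s) (η := η) (θ' := θ') (cV := cV) (mul_nonneg hϱ hBE) hθ' hθ'ρ hθ'η hE hvol hvol' i j
  have hexp : Real.exp (-(θ' * D i j)) = Real.exp (-(θ' / s * tdist1 Nf (locΛ i) (locΛ j))) := by
    congr 1; simp only [hDdef]; field_simp
  rw [← Matrix.sub_apply]
  calc ‖(invSqrt (PB σ) - invSqrt (PA σ)) i j‖ ≤ 4 * (ϱ * BE) * cV ^ 2 / (m * Real.sqrt m) * Real.exp (-(θ' * D i j)) := h2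
    _ = ϱ * ((4 * BE * cV ^ 2 / (m * Real.sqrt m)) * Real.exp (-(θ' / s * tdist1 Nf (locΛ i) (locΛ j)))) := by
        rw [hexp]; ring

end Sqrt


/-! ## §6 THE Γ-KERNEL SHAPE «local factor × square root» ([Balaban1988RG2Cluster] p. 13): (C1) of `σ ↦ K(σ)·(P(σ))^{−1/2}` end to end -/

section GammaShape

variable {p Λ : Type} [Fintype Λ] [DecidableEq Λ] {c : B13.Consts}

/-- **(C1) OF THE Γ-KERNEL SHAPE `σ ↦ K(σ)·(P(σ))^{−1/2}`** — part 1 §2 `close_mul` ∘ §5 `close_invSqrt` ∘ `B13Sqrt27Accretive.norm_invSqrt_apply_le`: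
a static LOCAL FACTOR `K_A, K_B : p × Λ` with (L1) of `K_A` (amplitude `B_K`) and the two-run letter (C1) (rate `ϱ`, amplitude `D_K`) at decay `θ′∕s` in
the located torus distance, and static PRECISION families `P_A, P_B : Λ × Λ` with the data of §5 ((C1) of `P` at rate `ϱ`, amplitude `B_E`, decay `ρ`);
a `d₁`-currency volume sum `Σ_k e^{−η₁d₁(loc i, loc k)} ≤ c_V₁` over the middle bonds, `ρ₁ + η₁ ≤ θ′∕s` ⟹ (C1) for the composite at rate `ϱ`, amplitude
`(D_K·(2∕√m) + B_K·(4B_Ec_V²∕(m√m)))·c_V₁`, decay `ρ₁`.  So a PRIMITIVE two-run rate for the local factor and for the precision IS a two-run rate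
for the Γ-kernel read as «local factor × square root of the covariance» — the `hcloseΓ` binder of
`N18TwoRunLetters.termWalkData_of_staticLetters_at_window` for such a kernel, by name.  Nothing of Bałaban's `C*Δ_k(σ)C`, `C^{(k)}` is
instantiated; which primitives carry the rate is rows NE2∕NE3's ∕ NODE O's content.
[cite: Balaban1988RG2Cluster, (2.7) p.13, p.15, (2.14)–(2.16) p.16; Balaban1985BackgroundPropagators, Thm 3.10 p.416; King1986, p.665 and p.675] -/
theorem close_mul_invSqrt (locp : p → UT Nf) (locΛ : Λ → UT Nf)
    (KA KB : (TPt d N' → ℂ) → Matrix p Λ ℂ) (PA PB : (TPt d N' → ℂ) → Matrix Λ Λ ℂ)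
    (dist : Λ → Λ → ℕ) (hd0 : ∀ i, dist i i = 0) (hds : ∀ i j, dist i j = dist j i)
    (hdt : ∀ i j k, dist i k ≤ dist i j + dist j k)
    {s : ℝ} (hs : 0 < s) (hloc : ∀ i j, tdist1 Nf (locΛ i) (locΛ j) ≤ s * dist i j)
    {h m θ η cV BE ρ θ' ϱ BK DK η₁ cV₁ ρ₁ : ℝ} (hm : 0 < m) (hθ : 0 ≤ θ) (hhθ : h * (Real.exp θ - 1) ≤ m / 2)
    (hBE : 0 ≤ BE) (hϱ : 0 ≤ ϱ) (hη : 0 ≤ η) (hθ' : 0 ≤ θ') (hθ'ρ : θ' ≤ ρ * s) (hθ'η : θ' + η ≤ θ)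
    (hBK : 0 ≤ BK) (hDK : 0 ≤ DK) (hρ₁ : 0 ≤ ρ₁) (hη₁ : 0 ≤ η₁) (hsplit₁ : ρ₁ + η₁ ≤ θ' / s)
    -- the local factor: (L1) of run A, (C1) of the pair, at decay `θ′∕s`
    (hKA : ∀ σ : TPt d N' → ℂ, (∀ j, ‖σ j‖ ≤ Real.exp c.κ₁) →
      ∀ i k, ‖KA σ i k‖ ≤ BK * Real.exp (-(θ' / s * tdist1 Nf (locp i) (locΛ k))))
    (hKclose : ∀ σ : TPt d N' → ℂ, (∀ j, ‖σ j‖ ≤ Real.exp c.κ₁) →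
      ∀ i k, ‖KB σ i k - KA σ i k‖ ≤ ϱ * (DK * Real.exp (-(θ' / s * tdist1 Nf (locp i) (locΛ k)))))
    -- the precisions: §5's data
    (hrangeA : ∀ σ : TPt d N' → ℂ, (∀ j, ‖σ j‖ ≤ Real.exp c.κ₁) → ∀ i j, PA σ i j ≠ 0 → dist i j ≤ 1)
    (hrangeB : ∀ σ : TPt d N' → ℂ, (∀ j, ‖σ j‖ ≤ Real.exp c.κ₁) → ∀ i j, PB σ i j ≠ 0 → dist i j ≤ 1)
    (hrowA : ∀ σ : TPt d N' → ℂ, (∀ j, ‖σ j‖ ≤ Real.exp c.κ₁) → ∀ i, ∑ j ∈ univ.filter (fun j => dist i j ≠ 0), ‖PA σ i j‖ ≤ h)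
    (hcolA : ∀ σ : TPt d N' → ℂ, (∀ j, ‖σ j‖ ≤ Real.exp c.κ₁) → ∀ j, ∑ i ∈ univ.filter (fun i => dist i j ≠ 0), ‖PA σ i j‖ ≤ h)
    (hrowB : ∀ σ : TPt d N' → ℂ, (∀ j, ‖σ j‖ ≤ Real.exp c.κ₁) → ∀ i, ∑ j ∈ univ.filter (fun j => dist i j ≠ 0), ‖PB σ i j‖ ≤ h)
    (hcolB : ∀ σ : TPt d N' → ℂ, (∀ j, ‖σ j‖ ≤ Real.exp c.κ₁) → ∀ j, ∑ i ∈ univ.filter (fun i => dist i j ≠ 0), ‖PB σ i j‖ ≤ h)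
    (haccA : ∀ σ : TPt d N' → ℂ, (∀ j, ‖σ j‖ ≤ Real.exp c.κ₁) →
      ∀ v : Λ → ℂ, m * ∑ i, ‖v i‖ ^ 2 ≤ (∑ i, star (v i) * (PA σ *ᵥ v) i).re)
    (haccB : ∀ σ : TPt d N' → ℂ, (∀ j, ‖σ j‖ ≤ Real.exp c.κ₁) →
      ∀ v : Λ → ℂ, m * ∑ i, ‖v i‖ ^ 2 ≤ (∑ i, star (v i) * (PB σ *ᵥ v) i).re)
    (hPclose : ∀ σ : TPt d N' → ℂ, (∀ j, ‖σ j‖ ≤ Real.exp c.κ₁) →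
      ∀ k l, ‖PB σ k l - PA σ k l‖ ≤ ϱ * (BE * Real.exp (-(ρ * tdist1 Nf (locΛ k) (locΛ l)))))
    (hvol : ∀ i, ∑ k, Real.exp (-(η * dist i k)) ≤ cV) (hvol' : ∀ j, ∑ l, Real.exp (-(η * dist l j)) ≤ cV)
    -- the volume sum for the product, in `d₁` currency
    (hvol₁ : ∀ i, ∑ k, Real.exp (-(η₁ * tdist1 Nf (locp i) (locΛ k))) ≤ cV₁) :
    ∀ σ : TPt d N' → ℂ, (∀ j, ‖σ j‖ ≤ Real.exp c.κ₁) →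
      ∀ i j, ‖(KB σ * invSqrt (PB σ)) i j - (KA σ * invSqrt (PA σ)) i j‖
        ≤ ϱ * (((DK * (2 / Real.sqrt m) + BK * (4 * BE * cV ^ 2 / (m * Real.sqrt m))) * cV₁) *
            Real.exp (-(ρ₁ * tdist1 Nf (locp i) (locΛ j)))) := by
  -- (L1) of the run-B square root at decay `θ′∕s` (`norm_invSqrt_apply_le` and the rate comparison `(θ′∕s)·d₁ ≤ θ·dist`)
  have hrate : ∀ k j, θ' / s * tdist1 Nf (locΛ k) (locΛ j) ≤ θ * (dist k j : ℝ) := by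
    intro k j
    have hθ'θ : θ' ≤ θ := by linarith
    have hdkj : (0 : ℝ) ≤ dist k j := Nat.cast_nonneg _
    calc θ' / s * tdist1 Nf (locΛ k) (locΛ j) ≤ θ' / s * (s * dist k j) :=
          mul_le_mul_of_nonneg_left (hloc k j) (div_nonneg hθ' hs.le)
      _ = θ' * dist k j := by field_simp
      _ ≤ θ * dist k j := mul_le_mul_of_nonneg_right hθ'θ hdkj
  have hSB : ∀ σ : TPt d N' → ℂ, (∀ j, ‖σ j‖ ≤ Real.exp c.κ₁) →
      ∀ k j, ‖invSqrt (PB σ) k j‖ ≤ 2 / Real.sqrt m * Real.exp (-(θ' / s * tdist1 Nf (locΛ k) (locΛ j))) := by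
    intro σ hσ k j
    have h1 := norm_invSqrt_apply_le dist hd0 hds hdt (PB σ) (hrangeB σ hσ) h (hrowB σ hσ) (hcolB σ hσ) m θ hm hθ (haccB σ hσ) hhθ k j
    exact h1.trans (mul_le_mul_of_nonneg_left (Real.exp_le_exp.2 (neg_le_neg (hrate k j))) (div_nonneg zero_le_two (Real.sqrt_nonneg _)))
  have hSclose := close_invSqrt (c := c) locΛ PA PB dist hd0 hds hdt hs hloc hm hθ hhθ hBE hϱ hθ' hθ'ρ hθ'η hrangeA hrangeB hrowA hcolA hrowB hcolB
    haccA haccB hPclose hvol hvol'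
  exact close_mul (c := c) (locp := locp) (locq := locΛ) (locn := locΛ) (KA₁ := KA) (KB₁ := KB)
    (KA₂ := fun σ => invSqrt (PA σ)) (KB₂ := fun σ => invSqrt (PB σ)) hϱ hBK (div_nonneg zero_le_two (Real.sqrt_nonneg _)) hDK
    (by positivity) hρ₁ hη₁ hsplit₁ hKA hSB hKclose hSclose hvol₁

end GammaShape

end Summit.QuantumFields.YangMills.BalabanUVNodes.N18TwoRunLettersCalculusResolvent

end
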